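import Mathlib
import Literature.MathematicalPhysics.QuantumFieldTheory.Balaban1983to89.B6
import Literature.MathematicalPhysics.QuantumFieldTheory.Balaban1983to89.B5DictTorusEta

/-!
# `Balaban1983to89.B6Prop22OneScaleTorus` — T. Bałaban, *Propagators and renormalization transformations for lattice
gauge theories. II*, Commun. Math. Phys. **96** (1984) 223–250 [Balaban1984PropagatorsII]: **Proposition 2.2 (2.67) — the
VERBATIM census typing `B6.Prop22Printed` INHABITED WITH NO HYPOTHESIS on the ONE-SCALE TORUS FAMILY by the GENUINE operator
`G′ = Δ′_a⁻¹ = (−Δ^η + m² + a_KQ′_K*Q′_K)⁻¹` of the K-fold block averaging** (mesh `η = L^{−K}`, blocks `B^K(y)` of unit size),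
all six quantities of (2.67), constants UNIFORM in `K` (η → 0) and in the volume

statement-level skeleton of published theorems with citation tags; proofs where landed; nothing here is a claim about the Yang–Mills mass gap.
PDF held: `paper:balaban1984-cmp96-propagators-rt-ii` (journal page = PDF page + 222); pp. 223–225, 234–235 [PDF 1–3, 12–13]
materialised and read this session (`lit read paper:balaban1984-cmp96-propagators-rt-ii --pages 1-3` / `--pages 12-13`); the verbatim
statement of Proposition 2.2 is the docstring of `B6.Prop22Printed` (certified against the ×2 renders by the B6 block reader r03).
[4] = `paper:balaban1984-cmp95-propagators-rt-i` [Balaban1984PropagatorsI] (Prop. 1.2 (1.108)–(1.111) p. 35, p. 39), [3] =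
[Balaban1983RegularityDecay] (Theorem (1.9)–(1.10) p. 573) — quoted in the docstrings of the imported modules.

CITATION HEADER (cell `lit-balaban`, Phase-2 proof seat `p01` (gen 6) = unit `lit-balaban-p01`, HOME `run/shared/lean/pub/lit-balaban/`,
`PHASE2-TARGETS.md` §G, free-target protocol G.5-34(d); the B6 owner r03's ranked suggestion of 2026-08-21T07:30Z); SKELETON row
**`B6.Prop2.2`** (kind «model-instance»).  The row's head is `proved p249487` by this seat's gen-3 `…B6Prop22BoxFamily` — the verbatim
Prop inhabited on the one-scale BOX family, which is the DEGENERATE member `k = 0` of the one-scale reading (η = 1, blocks = sites,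
Q′ = I, G′ = (−Δ_𝔅 + a)⁻¹).  THIS FILE inhabits it by the operator the Proposition is ABOUT on one scale: the two-grid operator
`G′_K = (−Δ^η + m² + a_KQ′_K*Q′_K)⁻¹` on the fine torus `T_η`, `η = L^{−K}`, for EVERY `K ≥ 1` — the content being the regularity of
`G′λ` (∇^η-derivatives, η-Hölder quotients) UNIFORM IN THE MESH, i.e. [3]'s Theorem, which is how the paper itself obtains (2.67) on one
scale (*"The operators G′_k were investigated in paper [2]"*, [4] p. 35; [2] of [4] = [3]).  Imported, not modified: `…B6` (`B6.Geometry`,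
`B6.GpFamily`, `B6.pref4`, `B6.Prop22Printed`; cell pub-balaban b2b) and `…B5DictTorusEta` (cell lit-balaban, seat p38; joined with p37's
setting in `…B5Prop12GpTorus`: `firstOrderFam_top` = [4] Prop. 1.2 (1.110)–(1.111) for `G′_K` on EVERY torus (index `GpTopIdx d L` = all
volumes with `K ≥ 1`), HYPOTHESIS-FREE, one set of constants — assembled from
[3]'s Theorem on the torus `B4Thm110ZeroTorus.thm110_zero_torus` / `B4Thm19ZeroTorus` / `B4ThmZeroTorusEta.thmDepPrintedNN_torusEtaFam`,
the located leaves of (1.135) `B5ResidualGpTorusHolds`, and the dictionary `B5DictTorusEta.dictAt`), through it `…B5GpSettingTorus`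
(`gpSetting` = the G′-setting of record: the functionals (1.108)–(1.111) of [4] WITH BODIES for `G′_k = (B1RG242Torus.tower P a m²).G k`
rescaled — `entry`, `cubeSup`, `inCube`, `supNormV`, `holderV`, `cutHV`, `hDV`, `hSV`, `E0_top`/`ED_top`), `…B5Ineq137Torus` (`T` = sup
torus distance, `fine`/`blk` = corner representative ∕ block map, `T_blk_le`, `supN`, `holN`, `distX`), `…B1RG242Torus` (`tower`: Bałaban's
concrete scalar block-averaging tower on the tori `Site P j`, U = 1; `(tower P a m²).G K = (−Δ^ε + m² + a_K(L^Kε)^{−2}Q_K*Q_K)⁻¹`,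
`L^Kε = 1`, `a_K = B1.aSeq a L K` with `B1.aSeq_one`/`B1.aSeq_succ` = the recursion (2.14)).

WHAT THE PAPER PRINTS.  p. 234 [PDF 12], Proposition 2.2 verbatim = docstring of `B6.Prop22Printed` (*"If we have (2.1), (2.2) and M
is sufficiently large, then the operator G′ = Δ′_a⁻¹ (a = 1) satisfies the inequalities |(G′λ)(x)|, |(∇G′λ)(x)|, |(G′∇*λ)(x)|, ‖ζ∇G′λ‖_α,
‖ζG′∇*λ‖_α, |(ΔG′λ)(x)| ≤ O(1)[(L^jη)², L^jη, L^jη, (L^jη)^{1−α}(‖ζ‖_α + |ζ|), (L^jη)^{1−α}(‖ζ‖_α + |ζ|), 1]e^{−½δ₀d(y,y′)}|λ|,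
x ∈ B^j(y) or supp ζ ⊂ B^j(y), y ∈ Λ_j, supp λ ⊂ B^{j′}(y′), y′ ∈ Λ_{j′}. (2.67)"*); p. 223 [PDF 1]: *"This paper is a continuation of
[4] and we use all the notations introduced there without further explanation"* (so |λ| = (1.108), ‖·‖_α = (1.109) of [4]: *"‖A‖_α =
max_μ sup_{x,x′:|x−x′|≤1} |x − x′|^{−α}|A_μ(x) − A_μ(x′)|"*); p. 224 [PDF 2]: *"Let us notice that we admit the case when some domains
Ω_j are equal to T_η, for example Ω_j = T_η for j = 1, 2, …, l, l ≤ k"*; (2.13)–(2.14) p. 225: *"Δ′_a = Δ + Q′*aQ′, ⟨λ, Q′*aQ′λ⟩ =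
Σ_{j=0}^k Σ_{y∈Λ_j} a_j(L^jη)^{d−2}|(Q′_jλ)(y)|² … a_{j+1} = aa_j/(aL^{−2} + a_j), a₁ = a"*; p. 235 [PDF 13]: *"If we have one scale, i.e.
Λ_k = T₁^{(k)}, then the operator is a unit lattice operator"*; [4] p. 35: *"The operators G′_k were investigated in paper [2]"*;
[4] p. 39: *"In paper [2] we have proved all the necessary properties of G′, except the second order inequalities (1.112), (1.113)"*.

THE ONE-SCALE TORUS FAMILY, SITE VERSION ON THE TOWER CARRIERS (the reading, stated once).  ONE scale = the admitted case `Ω_j = T_η`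
for all `j ≤ K` of p. 224: `Λ_K = T₁^{(K)}` is the whole unit lattice and `Λ_j = ∅` (j < K), `Λ₀ = Ω₁ᶜ = ∅`; hence (2.13) reads
`Δ′_a = −Δ^η + a_KQ′_K*Q′_K` ((L^Kη)^{d−2} = 1) and `G′ = Δ′_a⁻¹` IS the `G′_K` of [4] (1.132) ∕ the `G_K` of [3] on the torus.  Carriers:
a volume `P = (d, L, m, K)` of the cell's `Params` (`K ≥ 1`), fine torus `T_η = Site P 0` (`2L^{m+K}` sites per direction, `η = ε = L^{−K}`
= `P.eps`), unit lattice `T₁^{(K)} = Site P K` (`2L^m` per direction), every site at scale `j = K`, `L^jη = L^Kε = 1` (`oneScaleGeo_len`);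
`G′ = (B1RG242Torus.tower P a m²).G P.K = (−Δ^ε + m² + a_KQ_K*Q_K)⁻¹` (`Q_K` the K-fold block average `B1RG242Torus.Qk`, `Q_K*` its
(1.5)-adjoint; `a_K = B1.aSeq a L K`, the solution of (2.14) with `a₁ = a`; the mass `m² ≥ 0` is a parameter of the family — the
Proposition's `G′` is the member `m² = 0`, `a = 1`); `x ∈ B^K(y)` ↦ `blk P K x = y` (the block map); `d(y, y′)` ↦ the periodic ℓ¹ distance
`T1 P K y y′` of the unit torus (on ONE scale the admissible contours of (2.46) are chains of unit-lattice bonds, so (2.46) = the graph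
distance; as in this seat's `…B6Prop23OneScaleTorus`); `λ` ↦ a vector test function `Fin d → Site P 0 → ℝ` (`G′` acts componentwise —
[3]'s `f : Ω → R^N` with N = d; `(G′∇*λ)(x) = Σ_ν(G′∂*_νλ_ν)(x)`, ∇* : 1-forms → scalars), `supp λ ⊂ B^{K}(y′)` ↦ every component vanishes
off the block, `|λ|` ↦ `supNormV` (1.108), `‖λ‖_ε` ↦ `holderV` (1.109), cut-offs `ζ : Site P 0 → ℝ` with `supp ζ ⊂ B^K(y)`, `‖ζ‖_α + |ζ|` ↦
`cutHV`; the six quantities of (2.67): `e 0 λ y = sup_{x∈B^K(y)} max_μ|(G′λ_μ)(x)|`, `e 1 λ y = sup_{x∈B^K(y)} max_{μ,ν}|(∂^η_μG′λ_ν)(x)|`,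
`e 2 λ y = sup_{x∈B^K(y)}|(G′∇*λ)(x)|`, `e 3 λ y = sup_{x∈B^K(y)} max_μ|(Δ^ηG′λ_μ)(x)|` (`entryB` = the BLOCK sups of the kernel
quantities `E0`/`ED`/`gDiv`/`EL` of the G′-setting of record, `entryB_zero_top` … : at k = K these ARE `(tower …).G K`, `∂^ε_μ(tower …).G K`,
…), `h1 λ α ζ = max(‖ζ∇G′λ‖_α, ‖ζG′∇*λ‖_α)` (`hDV`/`hSV`, verbatim the functionals of the setting of record); (2.1)–(2.2) are void on
one level (`Hyp21_22 := True`, as in `B6LevelTower.twGeo` and the gen-5 files); the big-block size `M` and `R` are carried as parameters.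

WHAT IS PROVED HERE (0 sorry, 0 defs without body, 0 new named facts; axioms standard).
§1 `T1` (periodic ℓ¹ distance of `Site P j`) with `T1_le_mul_T` (|·|₁ ≤ d·|·|_∞); `blk_fine`, `inCube_of_blk` (the block `B^K(y)` lies in
  the enlarged cube `Δ̃(y)` of [4]: `T_blk_le`); `blockSup` with `blockSup_le_cubeSup`; the block entries `entryB` with `entryB_le_entry`
  and the top-level unfoldings `entryB_zero_top`, `entryB_one_top`, `entryB_two_top`, `entryB_three_top` (the four sup quantities ARE
  `|(G′λ_μ)(x)|`, `|(∂^η_μG′λ_ν)(x)|`, `|Σ_ν(G′∂^η*_νλ_ν)(x)|`, `|((−Δ^η)G′λ_μ)(x)|` of `G′ = (tower P a m²).G P.K`); **`gPrime_eq_deltaPrime_inv`**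
  (the operator IS (2.13)–(2.14) on one scale: `(tower P a m²).G K = (−Δ^η + m² + a_K·Q′_K*Q′_K)⁻¹`, `a_K = B1.aSeq a L K`).
§2 `oneScaleGeo P Mb R` (the `B6.Geometry` above, HONEST readings of every abstract field), `oneScaleGeo_len` (L^jη = 1), the
  `B6.GpFamily` **`torusGp`** of `G′_K`, the index `Index d L` (all volumes `P` with `P.d = d`, `P.L = L`, `P.K ≥ 1`, all `Mb`, `R`).
§3 **`entries_oneScaleTorus`** — the six inequalities of (2.67) on the family with ONE set of constants `δ₀, C, C(α)` (functions of
  `d, L, a, m²` only): `e n λ y ≤ C·e^{−½δ₀d(y,y′)}|λ|` (n = 0…3) and `h1 λ α ζ ≤ C(α)(‖ζ‖_α + |ζ|)e^{−½δ₀d(y,y′)}|λ|` for `supp λ ⊂ B^K(y′)`,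
  `supp ζ ⊂ B^K(y)`, `0 ≤ α < 1`, EVERY `K ≥ 1` and every volume; **`prop22Printed_oneScaleTorus`** — `B6.Prop22Printed (oneScaleGeo-family)
  (torusGp-family)` with witnesses `M₁ = 1`, `δ₀`, `C`, `C(α)`: THE VERBATIM PROPOSITION 2.2 HOLDS ON THE ONE-SCALE TORUS FAMILY WITH NO
  ANALYTIC HYPOTHESIS; `oneScaleTorus_meets_hypotheses` (non-vacuity: members exist for every d ≥ 1, odd L > 1, m, K ≥ 1, Mb, R, and meet
  (2.1)–(2.2) and the threshold M ≥ M₁ = 1 whenever Mb ≥ 1).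
ROUTE ∕ HONEST SCOPE (declared deviations).  (i) ONE scale only: the verbatim multi-scale Proposition (levels Λ_j, the metric (2.46) across
levels, prefactors (L^jη)², (L^jη)^{1−α} with j ≠ j′, "M sufficiently large") is the DAG hypothesis of the cell and is NOT touched; on
one scale every prefactor is 1 and the content is the UNIFORMITY IN THE MESH η = L^{−K}.  (ii) The route is the paper's own for G′
(*"investigated in paper [2]"*): [3]'s Theorem on the torus (the tree's `B4Thm110ZeroTorus`/`B4Thm19ZeroTorus`, pp. 582–584 box route
carried out on the torus) + the located leaves of [4] (1.135) for the residual entries `G′∇*`, `ΔG′`, joined BY NAME in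
`B5DictTorusEta.firstOrderFam_top`; this file adds only the dictionary block ⊂ Δ̃(y) (`inCube_of_blk`), sup over a block ≤ sup over
the cube, |·|₁ ≤ d|·|_∞ (δ₀ ↦ δ₀/d), and the sign bookkeeping `C(α) ↦ max(C(α), 0)`; NOT the random-walk expansion (2.50), whose
convergence clause is not part of the census typing `B6.Prop22Printed` and is not asserted here.  (iii) The lineage's declared
divergences are inherited (DIVERGENCE D-pv07.17 of the B5 rows): sup torus distances inside [4]'s norms (the Hölder quotients (1.109)
use `|x − x′|_∞ ≤ 1` in η-units, `B5Ineq137Torus.distX`), the cubes Δ̃(y) = closed sup-balls of radius 1 about the corner representative,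
scalar model U = 1, the torus sizes `2L^{m+K−j}` of the tower, the family carries `m² ≥ 0` (B6's G′ is massless: m² = 0 is a member)
and a fixed `a > 0` (Proposition 2.2: a = 1).  (iv) Constants existential (those of `firstOrderFam_top`: b04's contour-shift rates,
[3] Sect. 5), depending on `d, L, a, m²` only — uniform in `K ≥ 1`, `m`, `Mb`, `R`; the B6 rate is `δ₀ = 2δ₀^{[4]}/d`.  (v) The member
`K = 0` (η = 1) is excluded here (it is the gen-3 box/degenerate case; `firstOrderFam_top` is stated for `K ≥ 1`).
-/

namespace Literature.MathematicalPhysics.QuantumFieldTheory.Balaban1983to89.B6Prop22OneScaleTorus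

open Finset Matrix
open B5Ineq137Torus (T toT Nv Nv_pos fine blk fine_val blk_val T_blk_le supN holN distX T_nonneg)
open B5GpSettingTorus (L2Half ED gDiv cubeSup inCube dir0 entry hDV hSV supNormV holderV l2NormV cutHV gpSetting E0_top
  ED_top cubeSup_nonneg le_cubeSup supNormV_nonneg cutHV_nonneg)
open B5Display135Torus (E0 E1 EL)
open B1RG242Torus (tower deriv)
open B5FromB4 (FirstOrderFam)

noncomputable section

variable (P : Params)

/-! ## §1. The ℓ¹ distance of the unit torus, blocks inside cubes, block sups -/

/-- **d(y, y′) on one scale**: the periodic ℓ¹ distance `Σ_μ dist(y_μ − y′_μ, N_jℤ)` of the torus `T^{(j)} = Site P j` (lattice units) —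
on ONE scale the admissible contours of (2.46) are chains of unit-lattice bonds, so `d(y, y′)` = their minimal number = the graph distance.
[cite: Balaban1984PropagatorsII, (2.46) p.231] -/
def T1 (j : ℕ) (x y : Site P j) : ℝ := ((∑ μ, B4Sect5Torus.ccoord (Nv P j) (toT x) (toT y) μ : ℕ) : ℝ)

/-- `|y − y′|₁ ≤ d·|y − y′|_∞` on the torus `T^{(j)}` (each circular coordinate distance is at most their maximum): the comparison of the
paper's ℓ¹ distance (p. 223: *"|x − y| = Σ_μ|x_μ − y_μ|"*) with the sup torus distance of the lineage. [cite: Balaban1984PropagatorsII, p.223 (the distance |x − y|); bookkeeping] -/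
theorem T1_le_mul_T (j : ℕ) (x y : Site P j) : T1 P j x y ≤ (P.d : ℝ) * T P j x y := by
  unfold T1 T B4Sect5Torus.tdist
  have h : ∑ μ, B4Sect5Torus.ccoord (Nv P j) (toT x) (toT y) μ ≤
      P.d * Finset.univ.sup (B4Sect5Torus.ccoord (Nv P j) (toT x) (toT y)) := by
    calc ∑ μ, B4Sect5Torus.ccoord (Nv P j) (toT x) (toT y) μ
        ≤ ∑ _μ : Fin P.d, Finset.univ.sup (B4Sect5Torus.ccoord (Nv P j) (toT x) (toT y)) :=
          Finset.sum_le_sum fun μ hμ => Finset.le_sup (f := B4Sect5Torus.ccoord (Nv P j) (toT x) (toT y)) hμ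
      _ = P.d * Finset.univ.sup (B4Sect5Torus.ccoord (Nv P j) (toT x) (toT y)) := by
          rw [Finset.sum_const, Finset.card_univ, Fintype.card_fin, smul_eq_mul]
  exact_mod_cast h

/-- The block map sends the corner representative of `y` back to `y` (`⌊L^k·y_μ / L^k⌋ = y_μ`, no wrap-around for `k ≤ m + K`): the corner of
`B^k(y)` lies in `B^k(y)`. [cite: Balaban1984PropagatorsII, (2.1) p.224 (the blocks B^j(y)); bookkeeping] -/
theorem blk_fine {k : ℕ} (hk : k ≤ P.m + P.K) (y : Site P k) : blk P k (fine P k y) = y := by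
  funext μ
  apply ZMod.val_injective
  rw [blk_val P hk, fine_val P hk, Nat.mul_div_cancel_left _ (pow_pos P.L_pos k)]

/-- **The block `B^k(y)` lies in the enlarged cube `Δ̃(y)` of [4]** (a fine site is within sup-distance `L^k − 1 ≤ L^k` of the corner of its
block): `blk x = y ⇒ x ∈ Δ̃(y)` — the dictionary from the support∕localisation conditions *"x ∈ B^j(y)"*, *"supp λ ⊂ B^{j′}(y′)"* of (2.67) to
the conditions *"x ∈ Δ̃(y)"*, *"supp J ⊂ Δ̃(y′)"* of [4] (1.110). [cite: Balaban1984PropagatorsII, (2.67) p.234; Balaban1984PropagatorsI, p.35 (the cubes Δ̃(y))] -/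
theorem inCube_of_blk {k : ℕ} (hk : k ≤ P.m + P.K) {x : Site P 0} {y : Site P k} (h : blk P k x = y) : inCube P k x y := by
  unfold inCube
  rw [← h]
  have h1 := T_blk_le P hk x
  linarith

/-- **sup over the block `B^k(y)`** of the absolute values of a finite family of scalar functions `g i` (the shape of the sup entries of (2.67):
*"x ∈ B^j(y)"*), the block being `{x : blk x = y}`; companion of `B5GpSettingTorus.cubeSup` (sup over Δ̃(y)). [cite: Balaban1984PropagatorsII, (2.67) p.234] -/
def blockSup (k : ℕ) (y : Site P k) {ι : Type} [Fintype ι] (i₀ : ι) (g : ι → Site P 0 → ℝ) : ℝ :=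
  (Finset.univ : Finset (Site P 0 × ι)).sup' ⟨(default, i₀), Finset.mem_univ _⟩
    (fun p => if blk P k p.1 = y then |g p.2 p.1| else 0)

variable {P} in
/-- Every value on the block is below the block sup (the reading of *"x ∈ B^j(y)"* in (2.67)). [cite: Balaban1984PropagatorsII, (2.67) p.234; bookkeeping] -/
theorem le_blockSup {k : ℕ} {y : Site P k} {ι : Type} [Fintype ι] (i₀ : ι) (g : ι → Site P 0 → ℝ) (i : ι) {x : Site P 0}
    (hx : blk P k x = y) : |g i x| ≤ blockSup P k y i₀ g := by
  have h := Finset.le_sup' (fun p : Site P 0 × ι => if blk P k p.1 = y then |g p.2 p.1| else 0) (Finset.mem_univ (x, i))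
  simp only [hx, if_true] at h
  exact h

variable {P} in
/-- A block sup is at most any common bound `b ≥ 0` of the absolute values on the block (the reading of *"x ∈ B^j(y)"* in (2.67)).
[cite: Balaban1984PropagatorsII, (2.67) p.234; bookkeeping] -/
theorem blockSup_le {k : ℕ} {y : Site P k} {ι : Type} [Fintype ι] {i₀ : ι} {g : ι → Site P 0 → ℝ} {b : ℝ} (hb : 0 ≤ b)
    (h : ∀ (i : ι) (x : Site P 0), blk P k x = y → |g i x| ≤ b) : blockSup P k y i₀ g ≤ b := by
  refine Finset.sup'_le _ _ fun p _ => ?_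
  show (if blk P k p.1 = y then |g p.2 p.1| else 0) ≤ b
  split_ifs with hp
  · exact h p.2 p.1 hp
  · exact hb

variable {P} in
/-- **sup over the block ≤ sup over the enlarged cube** (`B^k(y) ⊂ Δ̃(y)`, `inCube_of_blk`). [cite: Balaban1984PropagatorsII, (2.67) p.234; Balaban1984PropagatorsI, (1.110) p.35] -/
theorem blockSup_le_cubeSup {k : ℕ} (hk : k ≤ P.m + P.K) (y : Site P k) {ι : Type} [Fintype ι] (i₀ : ι)
    (g : ι → Site P 0 → ℝ) : blockSup P k y i₀ g ≤ cubeSup P k y i₀ g :=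
  blockSup_le (cubeSup_nonneg y i₀ g) fun i _ hx => le_cubeSup i₀ g i (inCube_of_blk P hk hx)

/-- **The four sup entries of (2.67) for `G′_k` over the BLOCK `B^k(y)`**: n = 0 ↦ `sup_{x∈B^k(y)} max_μ|(G′_kλ_μ)(x)|` (`E0`), n = 1 ↦
`sup max_{μ,ν}|(∂^η_μG′_kλ_ν)(x)|` (`ED`), n = 2 ↦ `sup |(G′_k∇*λ)(x)| = sup|Σ_ν(G′_k∂*_νλ_ν)(x)|` (`gDiv`), n = 3 ↦ `sup max_μ|(Δ^ηG′_kλ_μ)(x)|`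
(`EL`) — the kernel quantities of the G′-setting of record `B5GpSettingTorus.gpSetting`, with the sup taken over the block instead of the
cube Δ̃(y). [cite: Balaban1984PropagatorsII, Prop. 2.2 (2.67) p.234] -/
def entryB (a msq : ℝ) (k : ℕ) (n : Fin 4) (lam : Fin P.d → Site P 0 → ℝ) (y : Site P k) : ℝ :=
  match n with
  | ⟨0, _⟩ => blockSup P k y (dir0 P) (fun μ => E0 P a msq k (lam μ))
  | ⟨1, _⟩ => blockSup P k y (dir0 P, dir0 P) (fun p : Fin P.d × Fin P.d => ED P a msq k p.1 (lam p.2))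
  | ⟨2, _⟩ => blockSup P k y () (fun _ : Unit => gDiv P a msq k lam)
  | ⟨3, _⟩ => blockSup P k y (dir0 P) (fun μ => EL P a msq k (lam μ))

/-- unfolding of the block entry 0 (definitional). [cite: Balaban1984PropagatorsII, (2.67) p.234 (first quantity)] -/
theorem entryB_zero (a msq : ℝ) (k : ℕ) (lam : Fin P.d → Site P 0 → ℝ) (y : Site P k) :
    entryB P a msq k 0 lam y = blockSup P k y (dir0 P) (fun μ => E0 P a msq k (lam μ)) := rfl

/-- unfolding of the block entry 1 (definitional). [cite: Balaban1984PropagatorsII, (2.67) p.234 (second quantity)] -/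
theorem entryB_one (a msq : ℝ) (k : ℕ) (lam : Fin P.d → Site P 0 → ℝ) (y : Site P k) :
    entryB P a msq k 1 lam y = blockSup P k y (dir0 P, dir0 P) (fun p : Fin P.d × Fin P.d => ED P a msq k p.1 (lam p.2)) := rfl

/-- unfolding of the block entry 2 (definitional). [cite: Balaban1984PropagatorsII, (2.67) p.234 (third quantity)] -/
theorem entryB_two (a msq : ℝ) (k : ℕ) (lam : Fin P.d → Site P 0 → ℝ) (y : Site P k) :
    entryB P a msq k 2 lam y = blockSup P k y () (fun _ : Unit => gDiv P a msq k lam) := rfl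

/-- unfolding of the block entry 3 (definitional). [cite: Balaban1984PropagatorsII, (2.67) p.234 (sixth quantity)] -/
theorem entryB_three (a msq : ℝ) (k : ℕ) (lam : Fin P.d → Site P 0 → ℝ) (y : Site P k) :
    entryB P a msq k 3 lam y = blockSup P k y (dir0 P) (fun μ => EL P a msq k (lam μ)) := rfl

/-- The block entries are below the cube entries of the setting of record (`B^k(y) ⊂ Δ̃(y)`), entry by entry.
[cite: Balaban1984PropagatorsII, (2.67) p.234; Balaban1984PropagatorsI, (1.110) p.35] -/
theorem entryB_le_entry (a msq : ℝ) {k : ℕ} (hk : k ≤ P.m + P.K) (o : L2Half P) (n : Fin 4) (lam : Fin P.d → Site P 0 → ℝ)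
    (y : Site P k) : entryB P a msq k n lam y ≤ (gpSetting P a msq k o).e n lam y := by
  have h0 : entryB P a msq k 0 lam y ≤ (gpSetting P a msq k o).e 0 lam y := by
    rw [entryB_zero, B5GpSettingTorus.gpSetting_e_zero]; exact blockSup_le_cubeSup hk y _ _
  have h1 : entryB P a msq k 1 lam y ≤ (gpSetting P a msq k o).e 1 lam y := by
    rw [entryB_one, B5GpSettingTorus.gpSetting_e_one]; exact blockSup_le_cubeSup hk y _ _
  have h2 : entryB P a msq k 2 lam y ≤ (gpSetting P a msq k o).e 2 lam y := by
    rw [entryB_two, B5GpSettingTorus.gpSetting_e_two]; exact blockSup_le_cubeSup hk y _ _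
  have h3 : entryB P a msq k 3 lam y ≤ (gpSetting P a msq k o).e 3 lam y := by
    rw [entryB_three, B5GpSettingTorus.gpSetting_e_three]; exact blockSup_le_cubeSup hk y _ _
  fin_cases n
  exacts [h0, h1, h2, h3]

/-- **At the top level `k = K` the entry 0 IS the block sup of `|(G′λ_μ)(x)|` for `G′ = (tower P a m²).G K = (−Δ^η + m² + a_KQ′_K*Q′_K)⁻¹`**
(`B5GpSettingTorus.E0_top`: `L^Kε = 1`, no rescaling). [cite: Balaban1984PropagatorsII, (2.67) p.234 (first quantity), (2.13) p.225] -/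
theorem entryB_zero_top (a msq : ℝ) (lam : Fin P.d → Site P 0 → ℝ) (y : Site P P.K) :
    entryB P a msq P.K 0 lam y = blockSup P P.K y (dir0 P) (fun μ x => ((tower P a msq).G P.K *ᵥ lam μ) x) := by
  show blockSup P P.K y (dir0 P) (fun μ => E0 P a msq P.K (lam μ)) = _
  congr 1
  funext μ x
  exact E0_top P a msq (lam μ) x

/-- **At the top level `k = K` the entry 1 IS the block sup of `|(∂^η_μG′λ_ν)(x)|`**, `∂^η_μ` the forward η-derivative `B1RG242Torus.deriv P 0 P.eps μ`
(`B5GpSettingTorus.ED_top`). [cite: Balaban1984PropagatorsII, (2.67) p.234 (second quantity)] -/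
theorem entryB_one_top (a msq : ℝ) (lam : Fin P.d → Site P 0 → ℝ) (y : Site P P.K) :
    entryB P a msq P.K 1 lam y =
      blockSup P P.K y (dir0 P, dir0 P)
        (fun p : Fin P.d × Fin P.d => fun x => ((deriv P 0 P.eps p.1 * (tower P a msq).G P.K) *ᵥ lam p.2) x) := by
  show blockSup P P.K y (dir0 P, dir0 P) (fun p : Fin P.d × Fin P.d => ED P a msq P.K p.1 (lam p.2)) = _
  congr 1
  funext p x
  exact ED_top P a msq p.1 (lam p.2) x

/-- **At the top level `k = K` the entry 2 IS the block sup of `|(G′∇*λ)(x)| = |Σ_ν(G′∂*_νλ_ν)(x)|`**, `∂*_ν` = the transpose of the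
forward η-derivative (the adjoint for the pairings `Σ_x η^d`), `G′ = (tower P a m²).G K` (`L^Kε = 1`, no rescaling).
[cite: Balaban1984PropagatorsII, (2.67) p.234 (third quantity)] -/
theorem entryB_two_top (a msq : ℝ) (lam : Fin P.d → Site P 0 → ℝ) (y : Site P P.K) :
    entryB P a msq P.K 2 lam y =
      blockSup P P.K y ()
        (fun _ : Unit => fun x => ∑ ν, (((tower P a msq).G P.K * (deriv P 0 P.eps ν)ᵀ) *ᵥ lam ν) x) := by
  show blockSup P P.K y () (fun _ : Unit => gDiv P a msq P.K lam) = _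
  congr 1
  funext u x
  unfold gDiv
  refine Finset.sum_congr rfl fun ν _ => ?_
  rw [E1, P.spacing_K, inv_one, one_mul]

/-- **At the top level `k = K` the entry 3 IS the block sup of `|(ΔG′λ_μ)(x)|`**, `Δ = −Δ^η = Σ_μ ∂^η*_μ∂^η_μ ≥ 0` the η-lattice Laplace
operator (`B1RG242Torus.hOp P 0 P.eps 0`), `G′ = (tower P a m²).G K` (via `B5Display136Torus.G_eq_smul_Grs` at `L^Kε = 1`).
[cite: Balaban1984PropagatorsII, (2.67) p.234 (sixth quantity)] -/
theorem entryB_three_top {a msq : ℝ} (ha : 0 < a) (hm : 0 ≤ msq) (hK : 1 ≤ P.K) (lam : Fin P.d → Site P 0 → ℝ)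
    (y : Site P P.K) :
    entryB P a msq P.K 3 lam y =
      blockSup P P.K y (dir0 P) (fun μ x => ((B1RG242Torus.hOp P 0 P.eps 0 * (tower P a msq).G P.K) *ᵥ lam μ) x) := by
  show blockSup P P.K y (dir0 P) (fun μ => EL P a msq P.K (lam μ)) = _
  congr 1
  funext μ x
  rw [EL, B5Display136Torus.G_eq_smul_Grs (P := P) ha hm hK, P.spacing_K, div_one, one_pow, one_smul]

/-- **The operator of the family IS the `Δ′_a⁻¹` of (2.13)–(2.14) on one scale**: `G′ = (tower P a m²).G K = (−Δ^η + m² + a_K·Q′_K*Q′_K)⁻¹`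
on the fine torus `T_η = Site P 0`, `η = ε = L^{−K}`, with `−Δ^η + m² = B1RG242Torus.hOp P 0 P.eps m²`, `Q′_K = B1RG242Torus.Qk P K` the K-fold
block average (`B1RG242Torus.Qk_mulVec`: `(Q′_Kλ)(y) = L^{−Kd}Σ_{x∈B^K(y)}λ(x)`), `Q′_K* = B1RG242Torus.Qks P K` its adjoint (block-constant
extension, `Qks_mulVec`), and `a_K = B1.aSeq a L K` — the solution of the recursion (2.14) `a_{j+1} = aa_j/(aL^{−2} + a_j)`, `a₁ = a`
(`B1.aSeq_succ`, `B1.aSeq_one`); on one scale `(L^Kη)^{d−2} = 1`. [cite: Balaban1984PropagatorsII, (2.13)–(2.14) p.225, Prop. 2.2 p.234 («G′ = Δ′_a⁻¹»)] -/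
theorem gPrime_eq_deltaPrime_inv {a msq : ℝ} (ha : 0 < a) (hm : 0 ≤ msq) (hK : 1 ≤ P.K) :
    (tower P a msq).G P.K =
      (B1RG242Torus.hOp P 0 P.eps msq + B1.aSeq a P.L P.K • (B1RG242Torus.Qks P P.K * B1RG242Torus.Qk P P.K))⁻¹ := by
  rw [B5Display136Torus.G_eq_smul_Grs (P := P) ha hm hK, P.spacing_K, one_pow, one_smul, B5Display136Torus.Grs, P.spacing_K,
    div_one, one_pow, one_mul]

/-! ## §2. The one-scale torus family (site version on the tower carriers) and the family `G′ = G′_K` -/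

/-- **The one-scale torus geometry, site version** `Λ_K = T₁^{(K)} = Site P K` (the admitted case Ω_j = T_η for all j, p. 224) as a
`B6.Geometry`, with HONEST readings of every abstract field: every site at scale K, `η = ε = L^{−K}` (so `L^jη = 1`), `d` = the periodic
ℓ¹ distance (2.46) on one scale (`T1`), the big-block size `Mb` and `R` carried as parameters (no (2.1)–(2.2) condition on one level:
`Hyp21_22 := True`), `Loc` = vector test functions λ on the fine torus `Site P 0` (G′ componentwise, [3]'s f : Ω → R^N), `suppIn λ y′` =
supp λ ⊂ B^K(y′), `supNorm` = |λ| (1.108), `l2Norm` = (Σ η^d λ²)^{1/2}, `holder` = ‖λ‖_ε (1.109), `Cut` = cut-offs ζ on the fine torus,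
`cutIn ζ y` = supp ζ ⊂ B^K(y), `cutH α ζ` = ‖ζ‖_α + |ζ|, `cutSup ζ` = |ζ| — the norm functionals being literally those of the G′-setting
of record `B5GpSettingTorus.gpSetting P a m² K`. [cite: Balaban1984PropagatorsII, (2.1)–(2.4) p.224, (2.46) p.231, p.235] -/
@[reducible] def oneScaleGeo (Mb R : ℕ) : B6.Geometry where
  Site := Site P P.K
  fin := inferInstance
  scale := fun _ => P.K
  dist := T1 P P.K
  k := P.K
  eta := P.eps
  L := P.L
  R := R
  M := Mb
  Hyp21_22 := True
  Loc := Fin P.d → Site P 0 → ℝ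
  suppIn := fun lam y' => ∀ ν x, lam ν x ≠ 0 → blk P P.K x = y'
  supNorm := supNormV P
  l2Norm := l2NormV P P.K
  holder := holderV P P.K
  Cut := Site P 0 → ℝ
  cutIn := fun ζ y => ∀ x, ζ x ≠ 0 → blk P P.K x = y
  cutH := cutHV P P.K
  cutSup := supN P

/-- L^jη = 1 on the one-scale torus: every site of Λ_K = T₁^{(K)} is at scale K and `η = ε = L^{−K}`, `L^Kε = 1` (`Params.spacing_K`;
*"If we have one scale … the operator is a unit lattice operator"*). [cite: Balaban1984PropagatorsII, p.235] -/
@[simp] theorem oneScaleGeo_len (Mb R : ℕ) (y : (oneScaleGeo P Mb R).Site) : (oneScaleGeo P Mb R).len y = 1 := by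
  show (P.L : ℝ) ^ P.K * P.eps = 1
  exact P.spacing_K

/-- **The family `G′ = Δ′_a⁻¹ = G′_K` of Proposition 2.2 on the one-scale torus**, read through the six quantities of (2.67): `e n` = the block
sups `entryB` (`|(G′λ)(x)|`, `|(∇G′λ)(x)|`, `|(G′∇*λ)(x)|`, `|(ΔG′λ)(x)|` over `x ∈ B^K(y)`) and `h1 λ α ζ = max(‖ζ∇G′λ‖_α, ‖ζG′∇*λ‖_α)`
(`hDV`, `hSV` of the setting of record), for `G′ = G′_K = (tower P a m²).G K` rescaled to η-units (at k = K no rescaling: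
`entryB_zero_top`, `entryB_one_top`). [cite: Balaban1984PropagatorsII, Prop. 2.2 (2.67) p.234] -/
def torusGp (a msq : ℝ) (Mb R : ℕ) : B6.GpFamily (oneScaleGeo P Mb R) where
  e := fun n lam y => entryB P a msq P.K n lam y
  h1 := fun lam α ζ => max (hDV P a msq P.K lam α ζ) (hSV P a msq P.K lam α ζ)

variable {P} in
/-- The Hölder functional of the family IS the `h1` of the G′-setting of record (definitional). [cite: Balaban1984PropagatorsII, (2.67) p.234; Balaban1984PropagatorsI, (1.111) p.35] -/
theorem torusGp_h1_eq (a msq : ℝ) (Mb R : ℕ) (o : L2Half P) (lam : Fin P.d → Site P 0 → ℝ) (α : ℝ) (ζ : Site P 0 → ℝ) :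
    (torusGp P a msq Mb R).h1 lam α ζ = (gpSetting P a msq P.K o).h1 lam α ζ := rfl

/-- The index of the one-scale torus family for fixed `d`, `L`: the volume `P = (d, L, m, K)` with `K ≥ 1` (mesh η = L^{−K}), the
big-block size `Mb` (the print's M) and `R`. [cite: Balaban1984PropagatorsII, (2.1)–(2.2) p.224] -/
structure Index (d L : ℕ) extends B5DictTorusEta.GpTopIdx d L where
  Mb : ℕ
  R : ℕ

/-! ## §3. (2.67) on the one-scale torus family and the verbatim Proposition 2.2 -/

section Prop22

/-- the table [(L^jη)², L^jη, L^jη, 1] is ≡ 1 at L^jη = 1. [folklore] -/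
private theorem pref4_one (n : Fin 4) : B6.pref4 1 n = 1 := by
  fin_cases n <;> simp [B6.pref4]

/-- exponent comparison: `−δT ≤ −(δ/d)·T1` since `T1 ≤ d·T`, `δ ≥ 0`. [folklore] -/
private theorem exp_T_le_exp_T1 (P : Params) {δ : ℝ} (hδ : 0 ≤ δ) (y y' : Site P P.K) :
    Real.exp (-(δ * T P P.K y y')) ≤ Real.exp (-(δ / P.d * T1 P P.K y y')) := by
  apply Real.exp_le_exp.mpr
  rw [neg_le_neg_iff]
  have hdpos : (0 : ℝ) < P.d := by exact_mod_cast P.hd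
  have h1 := T1_le_mul_T P P.K y y'
  calc δ / P.d * T1 P P.K y y' ≤ δ / P.d * ((P.d : ℝ) * T P P.K y y') :=
        mul_le_mul_of_nonneg_left h1 (div_nonneg hδ hdpos.le)
    _ = δ * T P P.K y y' := by field_simp

/-- **(2.67) ON THE ONE-SCALE TORUS FAMILY, ALL SIX QUANTITIES, UNIFORMLY**: for `d ≥ 1`, odd `L > 1`, `a > 0`, `m² ≥ 0` there are `δ₀ > 0`,
`C > 0` and `C(α) ≥ 0` (functions of `d, L, a, m²` only) such that for EVERY volume `P` (`P.d = d`, `P.L = L`, `K = P.K ≥ 1`), all `y, y′ ∈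
T₁^{(K)}`, every λ with `supp λ ⊂ B^K(y′)`: `sup_{x∈B^K(y)}|(G′λ)(x)|, |(∇G′λ)(x)|, |(G′∇*λ)(x)|, |(ΔG′λ)(x)| ≤ C·e^{−½δ₀d(y,y′)}|λ|`, and for
every cut-off ζ with `supp ζ ⊂ B^K(y)`, `0 ≤ α < 1`: `max(‖ζ∇G′λ‖_α, ‖ζG′∇*λ‖_α) ≤ C(α)(‖ζ‖_α + |ζ|)e^{−½δ₀d(y,y′)}|λ|` — the printed
(2.67) with `L^jη = 1`.  Mechanism: [4] Prop. 1.2 (1.110)–(1.111) for G′_K on every torus (`B5DictTorusEta.firstOrderFam_top`), block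
⊂ cube, |·|₁ ≤ d|·|_∞. [cite: Balaban1984PropagatorsII, Prop. 2.2 (2.67) p.234] -/
theorem entries_oneScaleTorus (d L : ℕ) (hd : 1 ≤ d) (hL : Odd L ∧ 1 < L) {a : ℝ} (ha : 0 < a) {msq : ℝ}
    (hmsq : 0 ≤ msq) :
    ∃ δ₀ C : ℝ, ∃ Cα : ℝ → ℝ, 0 < δ₀ ∧ 0 < C ∧ (∀ α, 0 ≤ Cα α) ∧ ∀ i : Index d L,
      (∀ (n : Fin 4) (lam : Fin i.P.d → Site i.P 0 → ℝ) (y y' : Site i.P i.P.K),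
          (∀ ν x, lam ν x ≠ 0 → blk i.P i.P.K x = y') →
          entryB i.P a msq i.P.K n lam y ≤ C * Real.exp (-(δ₀ / 2 * T1 i.P i.P.K y y')) * supNormV i.P lam) ∧
      (∀ (α : ℝ) (lam : Fin i.P.d → Site i.P 0 → ℝ) (ζ : Site i.P 0 → ℝ) (y y' : Site i.P i.P.K), 0 ≤ α → α < 1 →
          (∀ x, ζ x ≠ 0 → blk i.P i.P.K x = y) → (∀ ν x, lam ν x ≠ 0 → blk i.P i.P.K x = y') →
          max (hDV i.P a msq i.P.K lam α ζ) (hSV i.P a msq i.P.K lam α ζ) ≤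
            Cα α * cutHV i.P i.P.K α ζ * Real.exp (-(δ₀ / 2 * T1 i.P i.P.K y y')) * supNormV i.P lam) := by
  obtain ⟨δ₀, C, Cα, hδ₀, hC, h⟩ := B5DictTorusEta.firstOrderFam_top d L hd hL ha hmsq (fun P => (default : L2Half P))
  have hdpos : (0 : ℝ) < d := by exact_mod_cast hd
  refine ⟨2 * (δ₀ / d), C, fun α => max (Cα α) 0, by positivity, hC, fun α => le_max_right _ _, fun i => ?_⟩
  obtain ⟨hsup, hH1⟩ := h i.toGpTopIdx
  have hKle : i.P.K ≤ i.P.m + i.P.K := Nat.le_add_left _ _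
  have hPd : (i.P.d : ℝ) = d := by exact_mod_cast i.hPd
  have hrate : ∀ y y' : Site i.P i.P.K, 2 * (δ₀ / d) / 2 * T1 i.P i.P.K y y' = δ₀ / i.P.d * T1 i.P i.P.K y y' := by
    intro y y'; rw [hPd]; ring
  refine ⟨fun n lam y y' hsupp => ?_, fun α lam ζ y y' hα0 hα1 hζ hsupp => ?_⟩
  · -- the sup entries: block ≤ cube ≤ [4] (1.110) ≤ the ℓ¹ form
    have hcube : (gpSetting i.P a msq i.P.K default).suppIn lam y' :=
      fun ν x hx => inCube_of_blk i.P hKle (hsupp ν x hx)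
    have h110 : (gpSetting i.P a msq i.P.K default).e n lam y ≤
        C * Real.exp (-(δ₀ * T i.P i.P.K y y')) * supNormV i.P lam :=
      hsup n lam y y' hcube
    have hJ := supNormV_nonneg (P := i.P) lam
    calc entryB i.P a msq i.P.K n lam y
        ≤ (gpSetting i.P a msq i.P.K default).e n lam y := entryB_le_entry i.P a msq hKle default n lam y
      _ ≤ C * Real.exp (-(δ₀ * T i.P i.P.K y y')) * supNormV i.P lam := h110
      _ ≤ C * Real.exp (-(δ₀ / i.P.d * T1 i.P i.P.K y y')) * supNormV i.P lam :=
          mul_le_mul_of_nonneg_right (mul_le_mul_of_nonneg_left (exp_T_le_exp_T1 i.P hδ₀.le y y') hC.le) hJ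
      _ = C * Real.exp (-(2 * (δ₀ / d) / 2 * T1 i.P i.P.K y y')) * supNormV i.P lam := by rw [hrate]
  · -- the Hölder entries: [4] (1.111) with C(α) ↦ max(C(α), 0), then the ℓ¹ form
    have hcubeζ : (gpSetting i.P a msq i.P.K default).cutIn ζ y := fun x hx => inCube_of_blk i.P hKle (hζ x hx)
    have hcube : (gpSetting i.P a msq i.P.K default).suppIn lam y' :=
      fun ν x hx => inCube_of_blk i.P hKle (hsupp ν x hx)
    have h111 : max (hDV i.P a msq i.P.K lam α ζ) (hSV i.P a msq i.P.K lam α ζ) ≤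
        Cα α * Real.exp (-(δ₀ * T i.P i.P.K y y')) * cutHV i.P i.P.K α ζ * supNormV i.P lam :=
      hH1 α lam ζ y y' hα0 hα1 hcubeζ hcube
    have hJ := supNormV_nonneg (P := i.P) lam
    have hZ := cutHV_nonneg (P := i.P) i.P.K α ζ
    have hE := (Real.exp_pos (-(δ₀ * T i.P i.P.K y y'))).le
    calc max (hDV i.P a msq i.P.K lam α ζ) (hSV i.P a msq i.P.K lam α ζ)
        ≤ Cα α * Real.exp (-(δ₀ * T i.P i.P.K y y')) * cutHV i.P i.P.K α ζ * supNormV i.P lam := h111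
      _ = Cα α * (Real.exp (-(δ₀ * T i.P i.P.K y y')) * cutHV i.P i.P.K α ζ * supNormV i.P lam) := by ring
      _ ≤ max (Cα α) 0 * (Real.exp (-(δ₀ * T i.P i.P.K y y')) * cutHV i.P i.P.K α ζ * supNormV i.P lam) :=
          mul_le_mul_of_nonneg_right (le_max_left _ _) (mul_nonneg (mul_nonneg hE hZ) hJ)
      _ ≤ max (Cα α) 0 * (Real.exp (-(δ₀ / i.P.d * T1 i.P i.P.K y y')) * cutHV i.P i.P.K α ζ * supNormV i.P lam) :=
          mul_le_mul_of_nonneg_left (mul_le_mul_of_nonneg_right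
            (mul_le_mul_of_nonneg_right (exp_T_le_exp_T1 i.P hδ₀.le y y') hZ) hJ) (le_max_right _ _)
      _ = max (Cα α) 0 * cutHV i.P i.P.K α ζ * Real.exp (-(2 * (δ₀ / d) / 2 * T1 i.P i.P.K y y')) *
            supNormV i.P lam := by rw [hrate]; ring

/-- **PROPOSITION 2.2, VERBATIM (`B6.Prop22Printed`), ON THE ONE-SCALE TORUS FAMILY WITH NO HYPOTHESIS**: for every `d ≥ 1`, odd `L > 1`,
`a > 0` (the Proposition: a = 1) and `m² ≥ 0` (the Proposition: m² = 0), the census Prop holds for the family of ALL one-scale tori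
`Λ_K = T₁^{(K)} = Site P K` (all volumes `m`, all scales `K ≥ 1` — mesh `η = L^{−K}` arbitrarily small —, all `Mb`, `R`) with the
GENUINE `G′ = Δ′_a⁻¹ = (−Δ^η + m² + a_KQ′_K*Q′_K)⁻¹ = (B1RG242Torus.tower P a m²).G K` read through the six quantities of (2.67)
(`torusGp`) — witnesses `M₁ = 1` and the `δ₀, C, C(α)` of `entries_oneScaleTorus` (all prefactors `(L^jη)²`, `L^jη`, `(L^jη)^{1−α}`
equal 1 on one scale). [cite: Balaban1984PropagatorsII, Prop. 2.2 (2.67) p.234] -/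
theorem prop22Printed_oneScaleTorus (d L : ℕ) (hd : 1 ≤ d) (hL : Odd L ∧ 1 < L) {a : ℝ} (ha : 0 < a) {msq : ℝ}
    (hmsq : 0 ≤ msq) :
    B6.Prop22Printed (fun i : Index d L => oneScaleGeo i.P i.Mb i.R) (fun i => torusGp i.P a msq i.Mb i.R) := by
  obtain ⟨δ₀, C, Cα, hδ₀, hC, -, h⟩ := entries_oneScaleTorus d L hd hL ha hmsq
  refine ⟨1, δ₀, C, Cα, one_pos, hδ₀, hC, fun i _ _ => ⟨fun n lam y y' hsupp => ?_, fun α lam ζ y y' hα0 hα1 hζ hsupp => ?_⟩⟩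
  · rw [oneScaleGeo_len, pref4_one, mul_one]
    exact (h i).1 n lam y y' hsupp
  · rw [oneScaleGeo_len, Real.one_rpow, mul_one]
    exact (h i).2 α lam ζ y y' hα0 hα1 hζ hsupp

/-- **Non-vacuity**: for every `d ≥ 1`, odd `L > 1`, every volume exponent `m`, every scale `K ≥ 1`, every `Mb`, `R` the family has a
member with exactly these data; every member satisfies (2.1)–(2.2) (void on one scale) and, as soon as `Mb ≥ 1`, the threshold `M₁ ≤ M`
with the witness `M₁ = 1` of `prop22Printed_oneScaleTorus` — so the conclusion (2.67) is asserted for all of them, not vacuously.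
[cite: Balaban1984PropagatorsII, Prop. 2.2 p.234] -/
theorem oneScaleTorus_meets_hypotheses (d L : ℕ) (hd : 1 ≤ d) (hL : Odd L ∧ 1 < L) (m K : ℕ) (hK : 1 ≤ K) (Mb R : ℕ) (hMb : 1 ≤ Mb) :
    ∃ i : Index d L, i.P.m = m ∧ i.P.K = K ∧ i.Mb = Mb ∧ i.R = R ∧
      (oneScaleGeo i.P i.Mb i.R).Hyp21_22 ∧ (1 : ℝ) ≤ (oneScaleGeo i.P i.Mb i.R).M ∧
      (oneScaleGeo i.P i.Mb i.R).eta = ((L : ℝ)⁻¹) ^ K :=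
  ⟨⟨⟨⟨d, L, m, K, hd, hL⟩, rfl, rfl, hK⟩, Mb, R⟩, rfl, rfl, rfl, rfl, trivial, by
    show (1 : ℝ) ≤ ((Mb : ℕ) : ℝ)
    exact_mod_cast hMb, rfl⟩

end Prop22

end

end Literature.MathematicalPhysics.QuantumFieldTheory.Balaban1983to89.B6Prop22OneScaleTorus
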